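import Summits.Parity.GeneralizedHardyLittlewood.Theorems.BeyondDiagonalBeatsQuarter.KernelFormXSqLocal
import Literature.NumberTheory.Sieve.PowerfulPartDecomposition
import Literature.NumberTheory.Sieve.DivisorBound
import HarnessLib

/-!
# The local factors behind the `X²` kernel form, II: `Σ_m |h_n(m)| m^{1/8} ≪ Σ_{d∣n} d^{−3/4}`

Supports stmt-Parity-20343 (`PrimeLevelFamEdge.BeyondDiagonalBeatsQuarter`, K_B; line
`diagonal_kernel_split`, registered stub `stub_kernelFormXSq`). A helper; it closes nothing. Namespace
`Summit.Parity.GeneralizedHardyLittlewood.Theorems.BeyondDiagonalBeatsQuarter.KernelFormXSq`.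

For the multiplicative function `h_n` of `KernelFormXSqLocal` (`f_n = τW1_{(·,n)=1} = (G∗G)∗h_n`) we
prove the uniform weighted `ℓ¹` bound that drives the error terms of the kernel asymptotics:

* `sum_abs_hloc_mul_rpow_le` — there is an absolute `C` with
  `Σ_{m ≤ N} |h_n(m)|·m^{1/8} ≤ C·D(n)` for all `N` and `n ≥ 1`, `D(n) = Σ_{d ∣ n} d^{−3/4}`;
* `summable_abs_hloc`, `tsum_abs_hloc_mul_rpow_le` — hence `Σ_m |h_n(m)| < ∞` and the same bound
  for the full series.

Proof: factor `m = k·u` into its powerful and exact parts (tree: `PowerfulPart.*`), use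
`|h_n(k)| ≤ τ(k)/k`, `|h_n(u)| ≤ τ(u)·gcd(n,u)/u²` (`KernelFormXSqLocal`), the divisor bound
`τ(m) ≤ C₁ m^{1/8}` (tree: `exists_card_divisors_le_mul_rpow`), `Σ_{k squarefull} k^{−3/4} ≤ 9`
(tree) and `gcd(n,u) ≤ Σ_{d∣n, d∣u} d`. Everything here is PROVED (theorems only).

## References
* E. Kowalski, P. Michel, J. VanderKam, J. reine angew. Math. 526 (2000), Prop. 5.1 p. 18 (absolute
  convergence of `ν(s)` near `s = 0`). [cite: KowalskiMichelVanderKam2000, Prop. 5.1 — derivation]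
«The programme SEARCHES and TYPES; no claim about Landau–Siegel zeros, Theorems 1–2 of
arXiv:2211.02515 or a repaired Margin232 until a kernel theorem says so.»
-/

noncomputable section

open scoped Real ArithmeticFunction.Moebius ArithmeticFunction.sigma ArithmeticFunction.zeta
open Finset ArithmeticFunction

namespace Summit.Parity.GeneralizedHardyLittlewood.Theorems.BeyondDiagonalBeatsQuarter.KernelFormXSq

open Literature.NumberTheory.LFunctions Literature.NumberTheory.LFunctions.KMV2000
open Literature.NumberTheory.Sieve Literature.NumberTheory.Sieve.PowerfulPart
open MollifierMainTerm (W G invA)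

/-! ### The two partial sums: powerful part and exact part -/

/-- `Σ_{k ≤ N, k squarefull} |h_n(k)|·k^{1/8} ≤ 9C₁` (`C₁` the divisor-bound constant at `ε = 1/8`).
[folklore] -/
theorem sum_squarefull_abs_hloc_le {C₁ : ℝ} (hC₁ : ∀ m : ℕ, m ≠ 0 → (m.divisors.card : ℝ) ≤ C₁ * (m : ℝ) ^ (1 / 8 : ℝ))
    (hC₁0 : 0 ≤ C₁) (n N : ℕ) :
    ∑ k ∈ (Icc 1 N).filter (fun k : ℕ ↦ ∀ p ∈ k.primeFactors, p ^ 2 ∣ k),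
        |hloc n k| * (k : ℝ) ^ (1 / 8 : ℝ) ≤ 9 * C₁ := by
  have hpt : ∀ k ∈ (Icc 1 N).filter (fun k : ℕ ↦ ∀ p ∈ k.primeFactors, p ^ 2 ∣ k),
      |hloc n k| * (k : ℝ) ^ (1 / 8 : ℝ) ≤ C₁ * (k : ℝ) ^ (-(3 / 4 : ℝ)) := by
    intro k hk
    have hk1 : 1 ≤ k := (Finset.mem_Icc.1 (Finset.mem_filter.1 hk).1).1
    have hk0 : (0 : ℝ) < k := by exact_mod_cast hk1
    have h1 := abs_hloc_le n (show k ≠ 0 by omega)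
    have h2 := hC₁ k (by omega)
    calc |hloc n k| * (k : ℝ) ^ (1 / 8 : ℝ)
        ≤ ((k.divisors.card : ℝ) / k) * (k : ℝ) ^ (1 / 8 : ℝ) :=
          mul_le_mul_of_nonneg_right h1 (by positivity)
      _ ≤ (C₁ * (k : ℝ) ^ (1 / 8 : ℝ) / k) * (k : ℝ) ^ (1 / 8 : ℝ) := by gcongr
      _ = C₁ * (k : ℝ) ^ (-(3 / 4 : ℝ)) := by
          rw [show (-(3 / 4 : ℝ)) = (1 / 8 + 1 / 8) - 1 by norm_num, Real.rpow_sub hk0,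
            Real.rpow_add hk0, Real.rpow_one]
          ring
  refine (Finset.sum_le_sum hpt).trans ?_
  rw [← Finset.mul_sum]
  refine (mul_le_mul_of_nonneg_left ?_ hC₁0).trans_eq (mul_comm _ _)
  calc ∑ k ∈ (Icc 1 N).filter (fun k : ℕ ↦ ∀ p ∈ k.primeFactors, p ^ 2 ∣ k), (k : ℝ) ^ (-(3 / 4 : ℝ))
      ≤ ∑ c ∈ Icc 1 N, ∑ a ∈ Icc 1 N, (((c ^ 2 * a ^ 3 : ℕ) : ℝ)) ^ (-(3 / 4 : ℝ)) :=
        sum_filter_squarefull_le N fun k ↦ by positivity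
    _ ≤ ∑ c ∈ Icc 1 N, ∑ a ∈ Icc 1 N, 1 / (((c : ℝ) * Real.sqrt c) * ((a : ℝ) * Real.sqrt a)) := by
        refine Finset.sum_le_sum fun c hc ↦ Finset.sum_le_sum fun a ha ↦ ?_
        exact rpow_neg_three_quarters_le (Finset.mem_Icc.1 hc).1 (Finset.mem_Icc.1 ha).1
    _ ≤ 9 := sum_box_le_nine N

/-- `gcd(n,u) ≤ Σ_{d ∣ n, d ∣ u} d` for `n ≥ 1` (the gcd is one of the terms). [folklore] -/
theorem gcd_le_sum_divisors {n : ℕ} (hn : n ≠ 0) (u : ℕ) :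
    (Nat.gcd n u : ℝ) ≤ ∑ d ∈ n.divisors.filter (fun d ↦ d ∣ u), (d : ℝ) := by
  have hmem : Nat.gcd n u ∈ n.divisors.filter (fun d ↦ d ∣ u) :=
    Finset.mem_filter.2 ⟨Nat.mem_divisors.2 ⟨Nat.gcd_dvd_left n u, hn⟩, Nat.gcd_dvd_right n u⟩
  exact Finset.single_le_sum (fun d _ ↦ Nat.cast_nonneg d) hmem

/-- `Σ_{u ≤ N, d ∣ u} u^{−7/4} ≤ d^{−7/4} · Z`, `Z = Σ_{v ≥ 1} v^{−7/4}`. [folklore] -/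
theorem sum_multiples_rpow_le {d : ℕ} (hd : d ≠ 0) (N : ℕ) :
    ∑ u ∈ (Icc 1 N).filter (fun u ↦ d ∣ u), (u : ℝ) ^ (-(7 / 4 : ℝ)) ≤
      (d : ℝ) ^ (-(7 / 4 : ℝ)) * ∑' v : ℕ, (v : ℝ) ^ (-(7 / 4 : ℝ)) := by
  have hsum : Summable fun v : ℕ ↦ (v : ℝ) ^ (-(7 / 4 : ℝ)) :=
    Real.summable_nat_rpow.2 (by norm_num)
  have hd0 : (0 : ℝ) ≤ d := Nat.cast_nonneg d
  -- reindex `u = d v`, `v ≤ N/d`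
  have hsub : (Icc 1 N).filter (fun u ↦ d ∣ u) = (Icc 1 (N / d)).image (fun v ↦ d * v) := by
    ext u
    simp only [Finset.mem_filter, Finset.mem_Icc, Finset.mem_image]
    constructor
    · rintro ⟨⟨hu1, huN⟩, ⟨v, rfl⟩⟩
      refine ⟨v, ⟨?_, ?_⟩, rfl⟩
      · rcases Nat.eq_zero_or_pos v with rfl | hv
        · omega
        · exact hv
      · exact (Nat.le_div_iff_mul_le (Nat.pos_of_ne_zero hd)).2 (by rwa [mul_comm] at huN)
    · rintro ⟨v, ⟨hv1, hvN⟩, rfl⟩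
      refine ⟨⟨?_, ?_⟩, dvd_mul_right d v⟩
      · exact Nat.one_le_iff_ne_zero.2 (mul_ne_zero hd (by omega))
      · have := (Nat.le_div_iff_mul_le (Nat.pos_of_ne_zero hd)).1 hvN
        rwa [mul_comm] at this
  rw [hsub, Finset.sum_image fun v _ w _ h ↦ (Nat.mul_right_inj hd).1 h]
  have hterm : ∀ v ∈ Icc 1 (N / d), (((d * v : ℕ) : ℝ)) ^ (-(7 / 4 : ℝ)) =
      (d : ℝ) ^ (-(7 / 4 : ℝ)) * (v : ℝ) ^ (-(7 / 4 : ℝ)) := by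
    intro v _
    push_cast
    exact Real.mul_rpow hd0 (Nat.cast_nonneg v)
  rw [Finset.sum_congr rfl hterm, ← Finset.mul_sum]
  refine mul_le_mul_of_nonneg_left ?_ (by positivity)
  exact hsum.sum_le_tsum _ fun v _ ↦ by positivity

/-- `Σ_{u ≤ N, u squarefree} |h_n(u)|·u^{1/8} ≤ C₁·Z·D(n)` with `D(n) = Σ_{d∣n} d^{−3/4}` (`n ≥ 1`).
[folklore] -/
theorem sum_squarefree_abs_hloc_le {C₁ : ℝ} (hC₁ : ∀ m : ℕ, m ≠ 0 → (m.divisors.card : ℝ) ≤ C₁ * (m : ℝ) ^ (1 / 8 : ℝ))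
    (hC₁0 : 0 ≤ C₁) {n : ℕ} (hn : n ≠ 0) (N : ℕ) :
    ∑ u ∈ (Icc 1 N).filter Squarefree, |hloc n u| * (u : ℝ) ^ (1 / 8 : ℝ) ≤
      C₁ * (∑' v : ℕ, (v : ℝ) ^ (-(7 / 4 : ℝ))) * ∑ d ∈ n.divisors, (d : ℝ) ^ (-(3 / 4 : ℝ)) := by
  set Z : ℝ := ∑' v : ℕ, (v : ℝ) ^ (-(7 / 4 : ℝ)) with hZ
  have hZ0 : 0 ≤ Z := tsum_nonneg fun v ↦ by positivity
  set U := (Icc 1 N).filter Squarefree with hU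
  -- pointwise: `|h_n(u)| u^{1/8} ≤ C₁ gcd(n,u) u^{-7/4}`
  have hpt : ∀ u ∈ U, |hloc n u| * (u : ℝ) ^ (1 / 8 : ℝ) ≤
      C₁ * ((Nat.gcd n u : ℝ) * (u : ℝ) ^ (-(7 / 4 : ℝ))) := by
    intro u hu
    have hu' := Finset.mem_filter.1 hu
    have hu1 : 1 ≤ u := (Finset.mem_Icc.1 hu'.1).1
    have hu0 : (0 : ℝ) < u := by exact_mod_cast hu1
    have h1 := abs_hloc_squarefree_le n hu'.2
    have h2 := hC₁ u (by omega)
    have hg0 : (0 : ℝ) ≤ Nat.gcd n u := Nat.cast_nonneg _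
    calc |hloc n u| * (u : ℝ) ^ (1 / 8 : ℝ)
        ≤ ((u.divisors.card : ℝ) * (Nat.gcd n u) / (u : ℝ) ^ 2) * (u : ℝ) ^ (1 / 8 : ℝ) :=
          mul_le_mul_of_nonneg_right h1 (by positivity)
      _ ≤ ((C₁ * (u : ℝ) ^ (1 / 8 : ℝ)) * (Nat.gcd n u) / (u : ℝ) ^ 2) * (u : ℝ) ^ (1 / 8 : ℝ) := by
          gcongr
      _ = C₁ * ((Nat.gcd n u : ℝ) * (u : ℝ) ^ (-(7 / 4 : ℝ))) := by
          rw [show (-(7 / 4 : ℝ)) = (1 / 8 + 1 / 8) - 2 by norm_num, Real.rpow_sub hu0,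
            Real.rpow_add hu0, show ((u : ℝ) ^ (2 : ℝ)) = (u : ℝ) ^ (2 : ℕ) by
              rw [← Real.rpow_natCast]; norm_num]
          ring
  refine (Finset.sum_le_sum hpt).trans ?_
  rw [← Finset.mul_sum, mul_assoc]
  refine mul_le_mul_of_nonneg_left ?_ hC₁0
  -- `gcd(n,u) ≤ Σ_{d | n, d | u} d`, then exchange
  have hstep : ∑ u ∈ U, (Nat.gcd n u : ℝ) * (u : ℝ) ^ (-(7 / 4 : ℝ)) ≤
      ∑ u ∈ U, ∑ d ∈ n.divisors, (if d ∣ u then (d : ℝ) * (u : ℝ) ^ (-(7 / 4 : ℝ)) else 0) := by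
    refine Finset.sum_le_sum fun u _ ↦ ?_
    rw [← Finset.sum_filter, ← Finset.sum_mul]
    exact mul_le_mul_of_nonneg_right (gcd_le_sum_divisors hn u) (by positivity)
  refine hstep.trans ?_
  rw [Finset.sum_comm, Finset.mul_sum]
  refine Finset.sum_le_sum fun d hd ↦ ?_
  have hd0 : d ≠ 0 := Nat.pos_iff_ne_zero.1 (Nat.pos_of_mem_divisors hd)
  have hd0' : (0 : ℝ) < d := by exact_mod_cast Nat.pos_of_ne_zero hd0
  rw [← Finset.sum_filter]
  calc ∑ u ∈ U.filter (fun u ↦ d ∣ u), (d : ℝ) * (u : ℝ) ^ (-(7 / 4 : ℝ))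
      = (d : ℝ) * ∑ u ∈ U.filter (fun u ↦ d ∣ u), (u : ℝ) ^ (-(7 / 4 : ℝ)) := by rw [Finset.mul_sum]
    _ ≤ (d : ℝ) * ∑ u ∈ (Icc 1 N).filter (fun u ↦ d ∣ u), (u : ℝ) ^ (-(7 / 4 : ℝ)) := by
        refine mul_le_mul_of_nonneg_left ?_ hd0'.le
        refine Finset.sum_le_sum_of_subset_of_nonneg ?_ fun u _ _ ↦ by positivity
        intro u hu
        simp only [hU, Finset.mem_filter] at hu ⊢
        exact ⟨hu.1.1, hu.2⟩
    _ ≤ (d : ℝ) * ((d : ℝ) ^ (-(7 / 4 : ℝ)) * Z) :=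
        mul_le_mul_of_nonneg_left (sum_multiples_rpow_le hd0 N) hd0'.le
    _ = Z * (d : ℝ) ^ (-(3 / 4 : ℝ)) := by
        rw [show (-(3 / 4 : ℝ)) = 1 + (-(7 / 4 : ℝ)) by norm_num, Real.rpow_add hd0', Real.rpow_one]
        ring


/-! ### The weighted `ℓ¹` bound -/

/-- **`Σ_{m ≤ N} |h_n(m)|·m^{1/8} ≤ C·Σ_{d∣n} d^{−3/4}`** for all `N` and `n ≥ 1`, with an absolute
constant `C` (factor `m` into its powerful and exact parts).
[cite: KowalskiMichelVanderKam2000, Prop. 5.1 — derivation (absolute convergence of the local factors)] -/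
theorem sum_abs_hloc_mul_rpow_le :
    ∃ C : ℝ, 0 < C ∧ ∀ n : ℕ, n ≠ 0 → ∀ N : ℕ,
      ∑ m ∈ Icc 1 N, |hloc n m| * (m : ℝ) ^ (1 / 8 : ℝ) ≤
        C * ∑ d ∈ n.divisors, (d : ℝ) ^ (-(3 / 4 : ℝ)) := by
  obtain ⟨C₁, hC₁1, hC₁⟩ := exists_card_divisors_le_mul_rpow (show (0 : ℝ) < 1 / 8 by norm_num)
  have hC₁0 : 0 ≤ C₁ := by linarith
  set Z : ℝ := ∑' v : ℕ, (v : ℝ) ^ (-(7 / 4 : ℝ)) with hZ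
  have hZ0 : 0 ≤ Z := tsum_nonneg fun v ↦ by positivity
  refine ⟨9 * C₁ * (C₁ * Z) + 1, by positivity, fun n hn N ↦ ?_⟩
  set K := (Icc 1 N).filter (fun k : ℕ ↦ ∀ p ∈ k.primeFactors, p ^ 2 ∣ k) with hK
  set U := (Icc 1 N).filter Squarefree with hU
  set A : ℕ → ℝ := fun k ↦ |hloc n k| * (k : ℝ) ^ (1 / 8 : ℝ) with hA
  have hA0 : ∀ k, 0 ≤ A k := fun k ↦ by positivity
  set D : ℝ := ∑ d ∈ n.divisors, (d : ℝ) ^ (-(3 / 4 : ℝ)) with hD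
  have hD0 : 0 ≤ D := Finset.sum_nonneg fun d _ ↦ by positivity
  -- factor each term through `m = powerfulPart m · exactPart m`
  have hfac : ∀ m ∈ Icc 1 N, A m = A (powerfulPart m) * A (exactPart m) := by
    intro m _
    simp only [hA]
    conv_lhs => rw [← powerfulPart_mul_exactPart m]
    rw [(isMultiplicative_hloc n).map_mul_of_coprime (coprime_powerfulPart_exactPart m), abs_mul,
      Nat.cast_mul, Real.mul_rpow (Nat.cast_nonneg _) (Nat.cast_nonneg _)]
    ring
  set φ : ℕ → ℕ × ℕ := fun m ↦ (powerfulPart m, exactPart m) with hφ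
  have hinj : Set.InjOn φ (Icc 1 N : Finset ℕ) := by
    intro m _ m' _ h
    simp only [hφ, Prod.mk.injEq] at h
    rw [← powerfulPart_mul_exactPart m, ← powerfulPart_mul_exactPart m', h.1, h.2]
  have himg : (Icc 1 N).image φ ⊆ K ×ˢ U := by
    intro q hq
    obtain ⟨m, hm, rfl⟩ := Finset.mem_image.1 hq
    have hm' := Finset.mem_Icc.1 hm
    have hm0 : m ≠ 0 := by omega
    simp only [hφ, Finset.mem_product, hK, hU, Finset.mem_filter, Finset.mem_Icc]
    refine ⟨⟨⟨powerfulPart_pos hm0, (Nat.le_of_dvd (by omega) (powerfulPart_dvd m)).trans hm'.2⟩,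
      fun p hp ↦ sq_dvd_powerfulPart_of_dvd (Nat.prime_of_mem_primeFactors hp)
        (Nat.dvd_of_mem_primeFactors hp)⟩,
      ⟨exactPart_pos m, (Nat.le_of_dvd (by omega) (exactPart_dvd m)).trans hm'.2⟩,
      squarefree_exactPart m⟩
  calc ∑ m ∈ Icc 1 N, A m = ∑ m ∈ Icc 1 N, A (φ m).1 * A (φ m).2 :=
        Finset.sum_congr rfl hfac
    _ = ∑ q ∈ (Icc 1 N).image φ, A q.1 * A q.2 := by rw [Finset.sum_image hinj]
    _ ≤ ∑ q ∈ K ×ˢ U, A q.1 * A q.2 :=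
        Finset.sum_le_sum_of_subset_of_nonneg himg fun q _ _ ↦ mul_nonneg (hA0 _) (hA0 _)
    _ = (∑ k ∈ K, A k) * ∑ u ∈ U, A u := by rw [Finset.sum_product, Finset.sum_mul_sum]
    _ ≤ (9 * C₁) * (C₁ * Z * D) :=
        mul_le_mul (sum_squarefull_abs_hloc_le hC₁ hC₁0 n N) (sum_squarefree_abs_hloc_le hC₁ hC₁0 hn N)
          (Finset.sum_nonneg fun u _ ↦ hA0 u) (by positivity)
    _ = (9 * C₁ * (C₁ * Z)) * D := by ring
    _ ≤ (9 * C₁ * (C₁ * Z) + 1) * D := by rw [add_mul, one_mul]; linarith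

/-- `1 ≤ m^{1/8}` for `m ≥ 1`, so `|h_n(m)| ≤ |h_n(m)|·m^{1/8}`. [folklore] -/
theorem abs_hloc_le_mul_rpow (n m : ℕ) : |hloc n m| ≤ |hloc n m| * (m : ℝ) ^ (1 / 8 : ℝ) := by
  rcases Nat.eq_zero_or_pos m with rfl | hm
  · simp
  · exact le_mul_of_one_le_right (abs_nonneg _)
      (Real.one_le_rpow (by exact_mod_cast hm) (by norm_num))

/-- `Σ_{i < N} |h_n(i)|·i^{1/8} ≤ C·D(n)` (range form of `sum_abs_hloc_mul_rpow_le`). [folklore] -/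
theorem sum_range_abs_hloc_mul_rpow_le {C : ℝ}
    (hC : ∀ n : ℕ, n ≠ 0 → ∀ N : ℕ, ∑ m ∈ Icc 1 N, |hloc n m| * (m : ℝ) ^ (1 / 8 : ℝ) ≤
      C * ∑ d ∈ n.divisors, (d : ℝ) ^ (-(3 / 4 : ℝ)))
    {n : ℕ} (hn : n ≠ 0) (N : ℕ) :
    ∑ m ∈ Finset.range N, |hloc n m| * (m : ℝ) ^ (1 / 8 : ℝ) ≤
      C * ∑ d ∈ n.divisors, (d : ℝ) ^ (-(3 / 4 : ℝ)) := by
  refine le_trans ?_ (hC n hn N)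
  have hsub : Finset.range N ⊆ insert 0 (Icc 1 N) := by
    intro m hm
    simp only [Finset.mem_range] at hm
    simp only [Finset.mem_insert, Finset.mem_Icc]
    omega
  calc ∑ m ∈ Finset.range N, |hloc n m| * (m : ℝ) ^ (1 / 8 : ℝ)
      ≤ ∑ m ∈ insert 0 (Icc 1 N), |hloc n m| * (m : ℝ) ^ (1 / 8 : ℝ) :=
        Finset.sum_le_sum_of_subset_of_nonneg hsub fun m _ _ ↦ by positivity
    _ = ∑ m ∈ Icc 1 N, |hloc n m| * (m : ℝ) ^ (1 / 8 : ℝ) := by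
        rw [Finset.sum_insert (by simp)]; simp

/-- **`Σ_m |h_n(m)| < ∞`** (`n ≥ 1`). [cite: KowalskiMichelVanderKam2000, Prop. 5.1 — derivation] -/
theorem summable_abs_hloc {n : ℕ} (hn : n ≠ 0) : Summable fun m ↦ |hloc n m| := by
  obtain ⟨C, -, hC⟩ := sum_abs_hloc_mul_rpow_le
  refine summable_of_sum_range_le (c := C * ∑ d ∈ n.divisors, (d : ℝ) ^ (-(3 / 4 : ℝ)))
    (fun m ↦ abs_nonneg _) fun N ↦ ?_
  exact (Finset.sum_le_sum fun m _ ↦ abs_hloc_le_mul_rpow n m).trans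
    (sum_range_abs_hloc_mul_rpow_le hC hn N)

/-- `Σ_m |h_n(m)|·m^{1/8} < ∞` (`n ≥ 1`). [folklore] -/
theorem summable_abs_hloc_mul_rpow {n : ℕ} (hn : n ≠ 0) :
    Summable fun m ↦ |hloc n m| * (m : ℝ) ^ (1 / 8 : ℝ) := by
  obtain ⟨C, -, hC⟩ := sum_abs_hloc_mul_rpow_le
  exact summable_of_sum_range_le (c := C * ∑ d ∈ n.divisors, (d : ℝ) ^ (-(3 / 4 : ℝ)))
    (fun m ↦ by positivity) fun N ↦ sum_range_abs_hloc_mul_rpow_le hC hn N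

/-- `h_n` is summable (`n ≥ 1`). [folklore] -/
theorem summable_hloc {n : ℕ} (hn : n ≠ 0) : Summable fun m ↦ hloc n m :=
  (summable_abs_hloc hn).of_abs

/-- **The full-series bound `Σ_m |h_n(m)|·m^{1/8} ≤ C·Σ_{d∣n} d^{−3/4}`** with the constant of
`sum_abs_hloc_mul_rpow_le`. [cite: KowalskiMichelVanderKam2000, Prop. 5.1 — derivation] -/
theorem tsum_abs_hloc_mul_rpow_le :
    ∃ C : ℝ, 0 < C ∧ ∀ n : ℕ, n ≠ 0 →
      ∑' m : ℕ, |hloc n m| * (m : ℝ) ^ (1 / 8 : ℝ) ≤ C * ∑ d ∈ n.divisors, (d : ℝ) ^ (-(3 / 4 : ℝ)) := by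
  obtain ⟨C, hC0, hC⟩ := sum_abs_hloc_mul_rpow_le
  exact ⟨C, hC0, fun n hn ↦ Real.tsum_le_of_sum_range_le (fun m ↦ by positivity)
    fun N ↦ sum_range_abs_hloc_mul_rpow_le hC hn N⟩

end Summit.Parity.GeneralizedHardyLittlewood.Theorems.BeyondDiagonalBeatsQuarter.KernelFormXSq
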